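import Literature.NumberTheory.Automorphic.UnitaryGroupAutomorphicRep
import Literature.NumberTheory.Automorphic.AdicCompletionCompact
import Mathlib.MeasureTheory.Measure.Haar.DistribChar
import HarnessLib

/-!
# Constant terms along the standard parabolics of `U_{E/F}(N)`, and the root formula for the
# modulus of the Borel torus (letters for the trace formula of the quasi-split unitary group)

Topic `NumberTheory/Automorphic`; namespace `Literature.NumberTheory.Automorphic.UnitaryGroup`.
DEFINITIONS with bodies + elementary lemmas; no named fact, no `sorry`, no instance, no notation.

* `constantTerm k ν 𝓕 φ g = (ν 𝓕)⁻¹ ∫_𝓕 φ(u g) dν(u)` — **the constant term of `φ` along the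
  standard maximal parabolic `P_k` of Mok's `U_{E/F}(N)`** (`unipotentRadical F E c N k = N_k(𝔸_F)`,
  `𝓕` a fundamental domain of `N_k(F)` — the realisation of `∫_{N_k(F)\N_k(𝔸_F)} φ(ng) dn` used by the
  tree's `CuspCondition` and `whittakerCoeff`; Mœglin–Waldspurger (1995), I.2.6; Borel–Jacquet
  (1979), 4.4; for `N = 3`, `k = 1`, `P_1 = B` is the Borel subgroup and this is Rogawski's `φ_N`,
  Arthur's `φ_P` entering the truncation `Λ^T`). Lemmas: `constantTerm_zero`, `constantTerm_add`,
  `constantTerm_smul`, and `CuspCondition.constantTerm_eq_zero` (a cusp form has vanishing constant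
  terms for every Haar measure and every fundamental domain — the tree's `CuspCondition` unfolded).
* `torusRootModulus d = (∏_{i<j} ‖dᵢ dⱼ⁻¹‖_{𝔸_E})^{1/2}` for `d : Fin N → 𝔸_E^×` — the ROOT FORMULA
  for the modulus of the Borel subgroup `B = T N` of `U(J_N)` at the diagonal element `diag(d)`
  (`‖·‖_{𝔸_E} = distribHaarChar`, the module of an idele): for `t = diag(d) ∈ T(𝔸_F)` (so
  `d_{rev i} = (c ⊗ 1)(dᵢ)⁻¹`) the positive roots of `U(J_N)` are the restrictions of those of
  `Res_{E/F} GL_N` with half the multiplicity, whence the square root of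
  `δ_{B_{GL_N}}(diag d) = ∏_{i<j} ‖dᵢ/dⱼ‖_{𝔸_E}`; for `N = 3`, `d = (a, b, ā⁻¹)`:
  `‖a‖_{𝔸_E}²` (Rogawski (1990), §1.10–§2). It is a monoid homomorphism (`torusRootModulus_mul`).
  The identification with Mathlib's `modularCharacter` of `B(𝔸_F)` is NOT proved here (its
  unramified local shadow is the tree's `relIndex_conjAct_borelInt_eq_pow_sum_unitary`); consumers
  who need it must state it.

## References

* C. Mœglin, J.-L. Waldspurger, *Spectral decomposition and Eisenstein series* (1995), I.2.6
  [MoeglinWaldspurger1995].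
* J. D. Rogawski, *Automorphic Representations of Unitary Groups in Three Variables* (1990),
  §1.10, §2 [Rogawski1990].
* A. Borel, H. Jacquet, *Automorphic forms and automorphic representations* (1979), 4.4
  [BorelJacquet1979].
-/

noncomputable section

open MeasureTheory NumberField IsDedekindDomain Matrix
open scoped MatrixGroups NNReal

namespace Literature.NumberTheory.Automorphic

namespace UnitaryGroup

/-! ## §1 Constant terms along `P_k` -/

section ConstantTerm

variable {F E : Type} [Field F] [NumberField F] [Field E] [NumberField E] [Algebra F E]
  {c : E ≃ₐ[F] E} {N : ℕ} {k : ℕ}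
  [MeasurableSpace (unipotentRadical F E c N k)]

/-- **The constant term of `φ : U_{E/F}(N)(𝔸_F) → ℂ` along the standard maximal parabolic `P_k`**,
realised with a Haar measure `ν` of `N_k(𝔸_F)` and a fundamental domain `𝓕` of `N_k(F)`:
`φ_{P_k}(g) = ν(𝓕)⁻¹ ∫_𝓕 φ(u g) dν(u)` (`= ∫_{N_k(F)\N_k(𝔸_F)} φ(ng) dn` for the probability Haar
measure of the compact quotient). Mœglin–Waldspurger (1995), I.2.6; for `U(3)` and `k = 1` this is
the constant term along the Borel subgroup, Rogawski (1990), §2. [cite: MoeglinWaldspurger1995, I.2.6] -/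
def constantTerm (k : ℕ) [MeasurableSpace (unipotentRadical F E c N k)]
    (ν : Measure (unipotentRadical F E c N k)) (𝓕 : Set (unipotentRadical F E c N k))
    (φ : (quasiSplit F E c N).Adelic → ℂ) (g : (quasiSplit F E c N).Adelic) : ℂ :=
  ((ν 𝓕).toReal⁻¹ : ℝ) • ∫ u in 𝓕, φ ((u : (quasiSplit F E c N).Adelic) * g) ∂ν

/-- Unfolding `constantTerm`. [cite: MoeglinWaldspurger1995, I.2.6] -/
theorem constantTerm_def (ν : Measure (unipotentRadical F E c N k)) (𝓕 : Set (unipotentRadical F E c N k))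
    (φ : (quasiSplit F E c N).Adelic → ℂ) (g : (quasiSplit F E c N).Adelic) :
    constantTerm k ν 𝓕 φ g =
      ((ν 𝓕).toReal⁻¹ : ℝ) • ∫ u in 𝓕, φ ((u : (quasiSplit F E c N).Adelic) * g) ∂ν := rfl

/-- The constant term of `0` is `0`. [cite: MoeglinWaldspurger1995, I.2.6] -/
@[simp] theorem constantTerm_zero (ν : Measure (unipotentRadical F E c N k))
    (𝓕 : Set (unipotentRadical F E c N k)) (g : (quasiSplit F E c N).Adelic) :
    constantTerm k ν 𝓕 (0 : (quasiSplit F E c N).Adelic → ℂ) g = 0 := by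
  simp [constantTerm]

/-- The constant term is additive in `φ` (on integrable data). [cite: MoeglinWaldspurger1995, I.2.6] -/
theorem constantTerm_add (ν : Measure (unipotentRadical F E c N k)) (𝓕 : Set (unipotentRadical F E c N k))
    {φ ψ : (quasiSplit F E c N).Adelic → ℂ} (g : (quasiSplit F E c N).Adelic)
    (hφ : IntegrableOn (fun u : unipotentRadical F E c N k => φ ((u : (quasiSplit F E c N).Adelic) * g)) 𝓕 ν)
    (hψ : IntegrableOn (fun u : unipotentRadical F E c N k => ψ ((u : (quasiSplit F E c N).Adelic) * g)) 𝓕 ν) :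
    constantTerm k ν 𝓕 (φ + ψ) g = constantTerm k ν 𝓕 φ g + constantTerm k ν 𝓕 ψ g := by
  simp only [constantTerm, Pi.add_apply]
  rw [integral_add hφ hψ, smul_add]

/-- The constant term is homogeneous in `φ`. [cite: MoeglinWaldspurger1995, I.2.6] -/
theorem constantTerm_smul (ν : Measure (unipotentRadical F E c N k)) (𝓕 : Set (unipotentRadical F E c N k))
    (a : ℂ) (φ : (quasiSplit F E c N).Adelic → ℂ) (g : (quasiSplit F E c N).Adelic) :
    constantTerm k ν 𝓕 (a • φ) g = a * constantTerm k ν 𝓕 φ g := by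
  simp only [constantTerm, Pi.smul_apply, smul_eq_mul]
  rw [integral_const_mul, mul_smul_comm]

/-- **Cusp forms have vanishing constant terms**: if `φ` satisfies the tree's `CuspCondition` along
`P_k`, then `φ_{P_k}(g) = 0` for every Haar measure of `N_k(𝔸_F)`, every fundamental domain of
`N_k(F)` and every `g`. Borel–Jacquet (1979), 4.4; Mœglin–Waldspurger (1995), I.2.18.
[cite: BorelJacquet1979, 4.4] -/
theorem _root_.Literature.NumberTheory.Automorphic.UnitaryGroup.CuspCondition.constantTerm_eq_zero
    [BorelSpace (unipotentRadical F E c N k)]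
    {φ : (quasiSplit F E c N).Adelic → ℂ} (hφ : CuspCondition F E c N φ k)
    (ν : Measure (unipotentRadical F E c N k)) [ν.IsHaarMeasure]
    {𝓕 : Set (unipotentRadical F E c N k)} (h𝓕 : IsFundamentalDomain (rationalUnipotentRadical F E c N k) 𝓕 ν)
    (g : (quasiSplit F E c N).Adelic) : constantTerm k ν 𝓕 φ g = 0 := by
  rw [constantTerm_def, (hφ ν 𝓕 h𝓕 g).2, smul_zero]

end ConstantTerm

/-! ## §2 The root formula for the modulus of the Borel torus -/

section Modulus

variable (E : Type) [Field E] [NumberField E] (N : ℕ)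

/-- **Root formula for the modulus of the Borel subgroup of `U(J_N)` on the diagonal torus**: for
`d : Fin N → 𝔸_E^×`, `torusRootModulus d = (∏_{i<j} ‖dᵢ dⱼ⁻¹‖_{𝔸_E})^{1/2}`, where
`‖x‖_{𝔸_E} = distribHaarChar 𝔸_E x` is the module of the idele `x` (product of the normalised local
absolute values). On `T(𝔸_F) = {diag(d) : d_{rev i} = (c ⊗ 1)(dᵢ)⁻¹}` this is the value at
`diag(d)` of the modular function `δ_B` of `B(𝔸_F) = T(𝔸_F) N(𝔸_F)` (the positive roots of the
quasi-split `U(J_N)` are the restrictions of those of `Res_{E/F} GL_N`, with half the total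
multiplicity: `δ_B = δ_{B_{GL_N}}^{1/2}`; for `N = 3`, `d = (a, b, ā⁻¹)`: `δ_B = ‖a‖_{𝔸_E}²`,
Rogawski (1990), §1.10–§2). Defined by the formula; the identification with Mathlib's
`modularCharacter` of `B(𝔸_F)` is not proved in this file. [cite: Rogawski1990, §1.10] -/
def torusRootModulus (d : Fin N → (AdeleRing (𝓞 E) E)ˣ) : ℝ≥0 :=
  letI : LocallyCompactSpace (AdeleRing (𝓞 E) E) := locallyCompactSpace_adeleRing' E
  NNReal.sqrt (∏ i : Fin N, ∏ j : Fin N,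
    (if i < j then distribHaarChar (AdeleRing (𝓞 E) E) (d i * (d j)⁻¹) else 1))

/-- Unfolding `torusRootModulus`. [cite: Rogawski1990, §1.10] -/
theorem torusRootModulus_def [LocallyCompactSpace (AdeleRing (𝓞 E) E)] (d : Fin N → (AdeleRing (𝓞 E) E)ˣ) :
    torusRootModulus E N d = NNReal.sqrt (∏ i : Fin N, ∏ j : Fin N,
      (if i < j then distribHaarChar (AdeleRing (𝓞 E) E) (d i * (d j)⁻¹) else 1)) := by
  unfold torusRootModulus
  congr

/-- `torusRootModulus 1 = 1`. [cite: Rogawski1990, §1.10] -/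
@[simp] theorem torusRootModulus_one : torusRootModulus E N 1 = 1 := by
  haveI : LocallyCompactSpace (AdeleRing (𝓞 E) E) := locallyCompactSpace_adeleRing' E
  rw [torusRootModulus_def]
  simp

/-- **`torusRootModulus` is multiplicative** (a character of the diagonal torus). [cite: Rogawski1990, §1.10] -/
theorem torusRootModulus_mul (d d' : Fin N → (AdeleRing (𝓞 E) E)ˣ) :
    torusRootModulus E N (d * d') = torusRootModulus E N d * torusRootModulus E N d' := by
  haveI : LocallyCompactSpace (AdeleRing (𝓞 E) E) := locallyCompactSpace_adeleRing' E
  rw [torusRootModulus_def, torusRootModulus_def, torusRootModulus_def, ← NNReal.sqrt_mul,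
    ← Finset.prod_mul_distrib]
  congr 1
  refine Finset.prod_congr rfl fun i _ => ?_
  rw [← Finset.prod_mul_distrib]
  refine Finset.prod_congr rfl fun j _ => ?_
  split_ifs
  · rw [← map_mul]
    congr 1
    rw [Pi.mul_apply, Pi.mul_apply, mul_inv]
    simp only [mul_assoc, mul_left_comm (d' i)]
  · rw [one_mul]

/-- `torusRootModulus` is positive. [cite: Rogawski1990, §1.10] -/
theorem torusRootModulus_pos (d : Fin N → (AdeleRing (𝓞 E) E)ˣ) : 0 < torusRootModulus E N d := by
  haveI : LocallyCompactSpace (AdeleRing (𝓞 E) E) := locallyCompactSpace_adeleRing' E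
  rw [torusRootModulus_def, NNReal.sqrt_pos]
  exact Finset.prod_pos fun i _ => Finset.prod_pos fun j _ => by
    split_ifs
    · exact distribHaarChar_pos
    · exact one_pos

end Modulus

end UnitaryGroup

end Literature.NumberTheory.Automorphic
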